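import Summits.QuantumFields.YangMills.Theorems.BalabanUVNodesN15TwoSpacingGluingNeumannKnitEntryZero
import Summits.QuantumFields.YangMills.Theorems.BalabanUVNodesN15TwoSpacingGluingNeumannKnitDefectRecordRows
import Summits.QuantumFields.YangMills.Theorems.BalabanUVNodesN15TwoSpacingGluingRecordKnitEntryOne
import HarnessLib

/-!
# THE GLUING STEP AT TWO LATTICE SPACINGS, LXX: ENTRY 0 AND THE REMAINDER OF THE RECORD COVER's PARAMETRIX — THE FIVE ROWS `G̃′`, `R`, `R′`, `𝔇(G̃′, G̃)`, `𝔇(R′, R)` ON THE TORUS OF RECORD,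
# VOLUME FREE (dag-n15-c g14, FILE 113 = 91R; N15 = NE2, s1 «background-layer OPERATOR ingredient»)

Cell `pub-ymgap`, seat `pub-ymgap-dag-n15-c` (R134 (a); HUMAN RULING D-0062), generation 14.  `bears_on: R4∕N15 · K3⁸ SpineGivenEndpointR13SepCoPHV (stmt-QuantumFields-27366)`.
Filed `--supports stmt-QuantumFields-27366 --as helper` — COUNT-NEUTRAL.  Theorems only (0 `def`, 0 `sorry`).  Imports BY NAME FILE 91 `…NeumannKnitEntryZero` (through it FILE 45 `hasMaj_parametrix` ∕
`hasMaj_idef_parametrix`, FILE 57 `hasMaj_remainder_in` ∕ `hasMaj_idef_remainder_in`, FILE 62 `parametrix_cut`, FILE 65 `hcube_cut`, FILE 67, FILE 72, FILE 81 `hasMaj_idef_commOp_deltaOp_comp_knitGR_closed`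
(the g12∕g13 record remainder defect, closed), `rpow_sixteenth_facts`), the g12 record rows `…NeumannKnitDefectRecordRows` (`hasMaj_commOp_deltaOp_comp_knitGR_row(_fine)`) and FILE 109
`…RecordKnitEntryOne` (FILE 73's cover, programme P: P-IIb `hasMaj_chiCube_liftCubeG`, P-IId `hasMaj_chiCube_liftCubeG_fine`, P-IIc `hasMaj_idef_chiCube_liftCubeG`); nothing in the tree is modified.

WHAT.  ★★★ **`knit_entryZero_rowsR`** — the record twin of FILE 91 `knit_entryZero_rows`: for odd `L ≥ 3`, `a > 0` there are `δ > 0`, `A, m₀, r₀ > 0`, `κ ≥ 0` such that for all `s`, `m_T ≥ s + 1`,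
`K ≥ 1` (`4 ≤ L^K`), `r`, on `MP (paramsOf d L m_T K hL)` with FILE 73's cover (lifted cubes `knitGR`, partition `knitHR`): `G̃′ ≤ A e^{−δd}` (fine), `R = remainder Δ_a h G ≤ (κ∕L^s) e^{−δd}` at
both spacings, `𝔇(G̃′, G̃) ≤ m₀ (L^K)^{−1∕16} e^{−δd}`, `𝔇(R′, R) ≤ r₀ (L^K)^{−1∕16} e^{−δd}` — rows 1, 2, 9 (both spacings), 12 of FILE 50's `GluedLetters` ON THE TORUS OF RECORD, all constants
free of `s`, of the volume `m_T`, of `K`, of `r`; the TRUE overlap `(L+1)^{d+1}`.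

HONEST FRAMING ∕ LIMITS.  Block-majorant bookkeeping over LANDED rows; `U ≡ 1` MODEL of [B6] §2's machine on the torus of record (cube letters from each cube's own doubled torus via programme
P: not circular in the volume); constants crude and ours; nothing of [B5]∕[B6] (2.38)–(2.40)∕[B9] Thm 3.1, 3.14 asserted.  NE2⁺ NOT PRINTED, NOT proved; N15 NOT discharged; counts of record
UNMOVED (typed 28∕28 · discharged 5∕27); one finite 𝕋⁴ at fixed ε per index — NOT infinite volume, NOT OS on ℝ⁴, NOT a mass gap, NOT Clay; R4 closes `BalabanLadder.UV` only.  Restate-immune.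
-/

noncomputable section

namespace Summit.QuantumFields.YangMills.BalabanUVNodes.N15.Gluing

open Real
open Literature.MathematicalPhysics.QuantumFieldTheory.Balaban1983to89
open Literature.MathematicalPhysics.QuantumFieldTheory.Balaban1983to89.B5Prop11Plancherel (Tor fine)
open Literature.MathematicalPhysics.QuantumFieldTheory.Balaban1983to89.B11SectG (BlockNorm HasMaj RowSum)
open Literature.MathematicalPhysics.QuantumFieldTheory.Balaban1983to89.T4EtaRateDefect (idef)
open Literature.MathematicalPhysics.QuantumFieldTheory.Balaban1983to89.T4EtaRateCoeffDefect (pull)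
open Literature.MathematicalPhysics.QuantumFieldTheory.Balaban1983to89.B6Prop26Gluing (mulOp mulOp_apply ind ind_nonneg ind_le_one)
open Literature.MathematicalPhysics.QuantumFieldTheory.Balaban1983to89.B6UnitTorusCarrier (unitTorusGeo)
open Literature.MathematicalPhysics.QuantumFieldTheory.Balaban1983to89.B5SiteBridgeP12 (MP)
open Literature.MathematicalPhysics.QuantumFieldTheory.King1986.Torus (blockOf tdistT tdistT_nonneg)
open Summit.QuantumFields.YangMills.BalabanUVNodes.N15.VectorPiece (bshiftEquiv kingPrV blkFine)
open Summit.QuantumFields.YangMills.BalabanUVNodes.N15.TwoGrid (paramsOf deltaOp chiCube cubeBlocks liftCubeG MP_dvd_MP hasMaj_chiCube_liftCubeG hasMaj_chiCube_liftCubeG_fine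
  hasMaj_idef_chiCube_liftCubeG)

variable {d : ℕ}

section Record

variable {L : ℕ} [NeZero L]

/-- ★★★ **ENTRY 0 AND THE REMAINDER OF THE RECORD COVER's PARAMETRIX — FIVE ROWS, VOLUME FREE** — the record twin of FILE 91 `knit_entryZero_rows`: for odd `L ≥ 3`, `a > 0` there are `δ > 0`,
`A, m₀, r₀ > 0`, `κ ≥ 0` with, for all `s`, `m_T ≥ s + 1`, `K ≥ 1` (`4 ≤ L^K`), `r`, on `MP (paramsOf d L m_T K hL)` with FILE 73's cover: `G̃′ ≤ A e^{−δd}` (fine spacing), `R ≤ (κ∕L^s) e^{−δd}`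
(both spacings), `𝔇(G̃′, G̃) ≤ m₀ (L^K)^{−1∕16} e^{−δd}`, `𝔇(R′, R) ≤ r₀ (L^K)^{−1∕16} e^{−δd}` — FILE 45∕57's engines with programme P's cut rows (both spacings), P-IIc's cut-cube defect,
the g12 record remainder rows `hasMaj_commOp_deltaOp_comp_knitGR_row(_fine)` and the closed record remainder defect `hasMaj_idef_commOp_deltaOp_comp_knitGR_closed`, `|h| ≤ 1`, FILE 67's fit,
the cut invisible (`parametrix_cut`), the TRUE overlap `(L+1)^{d+1}`. [cite: Balaban1984PropagatorsII, (2.91)–(2.93) p.239, (2.133)–(2.136) p.247 (shapes + mechanism); Balaban1985BackgroundPropagators,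
Thm 3.14 pp.426–427 (difference template); King1986, Prop. 3.9 (3.73) p.665 (rate factor)] -/
theorem knit_entryZero_rowsR (hL : Odd L ∧ 1 < L) {a : ℝ} (ha : 0 < a) :
    ∃ δ A κ m₀ r₀ : ℝ, 0 < δ ∧ 0 < A ∧ 0 ≤ κ ∧ 0 < m₀ ∧ 0 < r₀ ∧ ∀ (s mT K r : ℕ) (hs : s + 1 ≤ mT) (_hK : 1 ≤ K) (_hn4 : 4 ≤ L ^ K),
      HasMaj (BlockNorm.ofBlocks (unitTorusGeo L K (MP (paramsOf d L mT K hL)))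
          (fun i : Tor (fine (L ^ r * L ^ K) (MP (paramsOf d L mT K hL))) × Fin (d + 1) => blockOf (L ^ r * L ^ K) (MP (paramsOf d L mT K hL)) i.1))
        (BlockNorm.ofBlocks (unitTorusGeo L K (MP (paramsOf d L mT K hL)))
          (fun i : Tor (fine (L ^ r * L ^ K) (MP (paramsOf d L mT K hL))) × Fin (d + 1) => blockOf (L ^ r * L ^ K) (MP (paramsOf d L mT K hL)) i.1))
        (parametrix (knitHR d L s mT K (L ^ r * L ^ K) hL) (knitGR d L s mT K (L ^ r * L ^ K) hL hs a))
        (fun y y' => A * Real.exp (-(δ * tdistT (MP (paramsOf d L mT K hL)) y y'))) ∧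
      HasMaj (BlockNorm.ofBlocks (unitTorusGeo L K (MP (paramsOf d L mT K hL)))
          (fun b : Tor (fine (L ^ K) (MP (paramsOf d L mT K hL))) × Fin (d + 1) => blockOf (L ^ K) (MP (paramsOf d L mT K hL)) b.1))
        (BlockNorm.ofBlocks (unitTorusGeo L K (MP (paramsOf d L mT K hL)))
          (fun b : Tor (fine (L ^ K) (MP (paramsOf d L mT K hL))) × Fin (d + 1) => blockOf (L ^ K) (MP (paramsOf d L mT K hL)) b.1))
        (remainder (deltaOp (MP (paramsOf d L mT K hL)) (L ^ K) a) (knitHR d L s mT K (L ^ K) hL) (knitGR d L s mT K (L ^ K) hL hs a))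
        (fun y y' => κ / ((L ^ s : ℕ) : ℝ) * Real.exp (-(δ * tdistT (MP (paramsOf d L mT K hL)) y y'))) ∧
      HasMaj (BlockNorm.ofBlocks (unitTorusGeo L K (MP (paramsOf d L mT K hL)))
          (fun i : Tor (fine (L ^ r * L ^ K) (MP (paramsOf d L mT K hL))) × Fin (d + 1) => blockOf (L ^ r * L ^ K) (MP (paramsOf d L mT K hL)) i.1))
        (BlockNorm.ofBlocks (unitTorusGeo L K (MP (paramsOf d L mT K hL)))
          (fun i : Tor (fine (L ^ r * L ^ K) (MP (paramsOf d L mT K hL))) × Fin (d + 1) => blockOf (L ^ r * L ^ K) (MP (paramsOf d L mT K hL)) i.1))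
        (remainder (deltaOp (MP (paramsOf d L mT K hL)) (L ^ r * L ^ K) a) (knitHR d L s mT K (L ^ r * L ^ K) hL) (knitGR d L s mT K (L ^ r * L ^ K) hL hs a))
        (fun y y' => κ / ((L ^ s : ℕ) : ℝ) * Real.exp (-(δ * tdistT (MP (paramsOf d L mT K hL)) y y'))) ∧
      HasMaj (BlockNorm.ofBlocks (unitTorusGeo L K (MP (paramsOf d L mT K hL)))
          (fun b : Tor (fine (L ^ K) (MP (paramsOf d L mT K hL))) × Fin (d + 1) => blockOf (L ^ K) (MP (paramsOf d L mT K hL)) b.1))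
        (BlockNorm.ofBlocks (unitTorusGeo L K (MP (paramsOf d L mT K hL)))
          (fun i : Tor (fine (L ^ r * L ^ K) (MP (paramsOf d L mT K hL))) × Fin (d + 1) => blockOf (L ^ r * L ^ K) (MP (paramsOf d L mT K hL)) i.1))
        (idef (pull (kingPrV L K r (MP (paramsOf d L mT K hL)))) (pull (kingPrV L K r (MP (paramsOf d L mT K hL))))
          (parametrix (knitHR d L s mT K (L ^ r * L ^ K) hL) (knitGR d L s mT K (L ^ r * L ^ K) hL hs a)) (parametrix (knitHR d L s mT K (L ^ K) hL) (knitGR d L s mT K (L ^ K) hL hs a)))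
        (fun y y' => m₀ * ((L ^ K : ℕ) : ℝ) ^ (-(1 / 16 : ℝ)) * Real.exp (-(δ * tdistT (MP (paramsOf d L mT K hL)) y y'))) ∧
      HasMaj (BlockNorm.ofBlocks (unitTorusGeo L K (MP (paramsOf d L mT K hL)))
          (fun b : Tor (fine (L ^ K) (MP (paramsOf d L mT K hL))) × Fin (d + 1) => blockOf (L ^ K) (MP (paramsOf d L mT K hL)) b.1))
        (BlockNorm.ofBlocks (unitTorusGeo L K (MP (paramsOf d L mT K hL)))
          (fun i : Tor (fine (L ^ r * L ^ K) (MP (paramsOf d L mT K hL))) × Fin (d + 1) => blockOf (L ^ r * L ^ K) (MP (paramsOf d L mT K hL)) i.1))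
        (idef (pull (kingPrV L K r (MP (paramsOf d L mT K hL)))) (pull (kingPrV L K r (MP (paramsOf d L mT K hL))))
          (remainder (deltaOp (MP (paramsOf d L mT K hL)) (L ^ r * L ^ K) a) (knitHR d L s mT K (L ^ r * L ^ K) hL) (knitGR d L s mT K (L ^ r * L ^ K) hL hs a))
          (remainder (deltaOp (MP (paramsOf d L mT K hL)) (L ^ K) a) (knitHR d L s mT K (L ^ K) hL) (knitGR d L s mT K (L ^ K) hL hs a)))
        (fun y y' => r₀ * ((L ^ K : ℕ) : ℝ) ^ (-(1 / 16 : ℝ)) * Real.exp (-(δ * tdistT (MP (paramsOf d L mT K hL)) y y'))) := by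
  have hL3 : 3 ≤ L := by obtain ⟨⟨j, hj⟩, h1⟩ := hL; omega
  have hLpos : 0 < L := by omega
  have hLodd : Odd L := hL.1
  have hL2 : 2 ≤ L := hL.2
  obtain ⟨δ₀, C, hδ₀, hC, HG⟩ := hasMaj_chiCube_liftCubeG (d := d) hL ha
  obtain ⟨δ₀', C', hδ₀', hC', HG'⟩ := hasMaj_chiCube_liftCubeG_fine (d := d) hL ha
  obtain ⟨δc, mc, hδc, hmc, HC⟩ := hasMaj_idef_chiCube_liftCubeG (d := d) hLodd hL2 ha (γ := 1 / 8) (by norm_num) (by norm_num)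
  obtain ⟨δ7, Cr, hδ7, hCr, H7⟩ := hasMaj_idef_commOp_deltaOp_comp_knitGR_closed (d := d) hL ha
  obtain ⟨δK, κc, hδK, hκc, HK⟩ := hasMaj_commOp_deltaOp_comp_knitGR_row (d := d) hL ha
  obtain ⟨δK', κf, hδK', hκf, HK'⟩ := hasMaj_commOp_deltaOp_comp_knitGR_row_fine (d := d) hL ha
  set κ₀ : ℝ := κc + κf with hκ₀_def
  have hκ₀ : 0 ≤ κ₀ := by positivity
  have hκc' : κc ≤ κ₀ := by rw [hκ₀_def]; linarith
  have hκf' : κf ≤ κ₀ := by rw [hκ₀_def]; linarith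
  set δ : ℝ := min (min (min δ₀ δ₀') (min δK δK')) (min δc δ7) with hδ_def
  have hδ : 0 < δ := lt_min (lt_min (lt_min hδ₀ hδ₀') (lt_min hδK hδK')) (lt_min hδc hδ7)
  have hδ0' : δ ≤ δ₀ := (min_le_left _ _).trans ((min_le_left _ _).trans (min_le_left _ _))
  have hδ0'' : δ ≤ δ₀' := (min_le_left _ _).trans ((min_le_left _ _).trans (min_le_right _ _))
  have hδK2 : δ ≤ δK := (min_le_left _ _).trans ((min_le_right _ _).trans (min_le_left _ _))
  have hδK2' : δ ≤ δK' := (min_le_left _ _).trans ((min_le_right _ _).trans (min_le_right _ _))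
  have hδc' : δ ≤ δc := (min_le_right _ _).trans (min_le_left _ _)
  have hδ7' : δ ≤ δ7 := (min_le_right _ _).trans (min_le_right _ _)
  set Nov : ℝ := (((L + 1) ^ (d + 1) : ℕ) : ℝ) with hNov_def
  set β : ℝ := C + C' with hβ_def
  have hβ : 0 ≤ β := by positivity
  have hCβ : C ≤ β := by rw [hβ_def]; linarith [hC'.le]
  have hCβ' : C' ≤ β := by rw [hβ_def]; linarith [hC.le]
  refine ⟨δ, Nov * β + 1, Nov * κ₀, Nov * (2 * β * (π * (d + 1)) + mc) + 1, Nov * (κ₀ * (π * (d + 1)) + Cr) + 1, hδ, by positivity, by positivity, by positivity, by positivity,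
    fun s mT K r hs hK hn4 => ?_⟩
  -- the index's data
  set M : Fin (d + 1) → ℕ := MP (paramsOf d L mT K hL) with hMdef
  have hs' : s ≤ mT := by omega
  have hM : ∀ ν, M ν = 2 * L ^ (mT - s) * L ^ s := MP_eq_two_mul L s mT K hL hs'
  have hw : 0 < L ^ s := pow_pos hLpos s
  have hn : 1 ≤ L ^ K := Nat.one_le_pow _ _ hLpos
  have hfit := coverMargin_fit hL3 s
  have hSe : L ^ (s + 1) = L * L ^ s := by rw [pow_succ, mul_comm]
  have hfit1 : coverMargin L s + 2 * L ^ s + 1 ≤ L ^ (s + 1) := by rw [hSe]; omega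
  have hS : L ^ (s + 1) ≤ 2 * L ^ (mT - s) * L ^ s := by
    calc L ^ (s + 1) ≤ L ^ mT := Nat.pow_le_pow_right hLpos hs
      _ = L ^ (mT - s) * L ^ s := by rw [← pow_add]; congr 1; omega
      _ ≤ 2 * L ^ (mT - s) * L ^ s := by rw [mul_assoc]; omega
  have hdiv : L ^ (s + 1) / L ^ s + 1 = L + 1 := by rw [hSe, Nat.mul_div_cancel _ hw]
  have hexp16 : (-((1 : ℝ) / 8 / 2)) = -(1 / 16 : ℝ) := by norm_num
  have hwR : (1 : ℝ) ≤ ((L ^ s : ℕ) : ℝ) := by exact_mod_cast hw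
  have hwpos : (0 : ℝ) < ((L ^ s : ℕ) : ℝ) := by linarith
  have hnR : (1 : ℝ) ≤ ((L ^ K : ℕ) : ℝ) := by exact_mod_cast hn
  set ε : ℝ := ((L ^ K : ℕ) : ℝ) ^ (-(1 / 16 : ℝ)) with hε_def
  obtain ⟨-, hnwε, -, hε0⟩ := rpow_sixteenth_facts hnR hwR
  have hblk : (fun i : Tor (fine (L ^ r * L ^ K) M) × Fin (d + 1) => blockOf (L ^ r * L ^ K) M i.1) =
      (fun b : Tor (fine (L ^ K) M) × Fin (d + 1) => blockOf (L ^ K) M b.1) ∘ kingPrV L K r M := (VectorPiece.blkFine_comp_kingPrV (M := M) L K r).symm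
  have hind : ∀ (k : Fin (d + 1) → ZMod (2 * L ^ (mT - s))) (y y' : Tor M),
      0 ≤ ind (g := unitTorusGeo L K M) ((cubeBlocks M (coverCorner M (L ^ s) (L ^ (mT - s)) (coverMargin L s) k) (L ^ (s + 1)) : Finset (Tor M)) : Set (Tor M)) y *
        ind (g := unitTorusGeo L K M) ((cubeBlocks M (coverCorner M (L ^ s) (L ^ (mT - s)) (coverMargin L s) k) (L ^ (s + 1)) : Finset (Tor M)) : Set (Tor M)) y' :=
    fun k y y' => mul_nonneg (ind_nonneg _ _) (ind_nonneg _ _)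
  have hind1 : ∀ (k : Fin (d + 1) → ZMod (2 * L ^ (mT - s))) (y y' : Tor M),
      0 ≤ ind (g := unitTorusGeo L K M) ((cubeBlocks M (coverCorner M (L ^ s) (L ^ (mT - s)) (coverMargin L s) k) (L ^ (s + 1)) : Finset (Tor M)) : Set (Tor M)) y' :=
    fun k y y' => ind_nonneg _ _
  -- the cut rows at both spacings (rate weakened to `δ`)
  have hGc : ∀ k : Fin (d + 1) → ZMod (2 * L ^ (mT - s)),
      HasMaj (BlockNorm.ofBlocks (unitTorusGeo L K M) (fun b : Tor (fine (L ^ K) M) × Fin (d + 1) => blockOf (L ^ K) M b.1))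
        (BlockNorm.ofBlocks (unitTorusGeo L K M) (fun b : Tor (fine (L ^ K) M) × Fin (d + 1) => blockOf (L ^ K) M b.1))
        (mulOp (chiCube M (L ^ K) (coverCorner M (L ^ s) (L ^ (mT - s)) (coverMargin L s) k) (L ^ (s + 1))) ∘ₗ knitGR d L s mT K (L ^ K) hL hs a k)
        (fun y y' => ind ((cubeBlocks M (coverCorner M (L ^ s) (L ^ (mT - s)) (coverMargin L s) k) (L ^ (s + 1)) : Finset (Tor M)) : Set (Tor M)) y *
          ind ((cubeBlocks M (coverCorner M (L ^ s) (L ^ (mT - s)) (coverMargin L s) k) (L ^ (s + 1)) : Finset (Tor M)) : Set (Tor M)) y' * (β * Real.exp (-(δ * tdistT M y y')))) := fun k =>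
    (hasMaj_rate_le (hind k) hC.le hδ0' (HG (s + 1) mT K hs hK (coverCorner M (L ^ s) (L ^ (mT - s)) (coverMargin L s) k))).mono fun y y' =>
      mul_le_mul_of_nonneg_left (mul_le_mul_of_nonneg_right hCβ (Real.exp_nonneg _)) (hind k y y')
  have hGc' : ∀ k : Fin (d + 1) → ZMod (2 * L ^ (mT - s)),
      HasMaj (BlockNorm.ofBlocks (unitTorusGeo L K M) ((fun b : Tor (fine (L ^ K) M) × Fin (d + 1) => blockOf (L ^ K) M b.1) ∘ kingPrV L K r M))
        (BlockNorm.ofBlocks (unitTorusGeo L K M) ((fun b : Tor (fine (L ^ K) M) × Fin (d + 1) => blockOf (L ^ K) M b.1) ∘ kingPrV L K r M))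
        (mulOp (chiCube M (L ^ r * L ^ K) (coverCorner M (L ^ s) (L ^ (mT - s)) (coverMargin L s) k) (L ^ (s + 1))) ∘ₗ knitGR d L s mT K (L ^ r * L ^ K) hL hs a k)
        (fun y y' => ind ((cubeBlocks M (coverCorner M (L ^ s) (L ^ (mT - s)) (coverMargin L s) k) (L ^ (s + 1)) : Finset (Tor M)) : Set (Tor M)) y *
          ind ((cubeBlocks M (coverCorner M (L ^ s) (L ^ (mT - s)) (coverMargin L s) k) (L ^ (s + 1)) : Finset (Tor M)) : Set (Tor M)) y' * (β * Real.exp (-(δ * tdistT M y y')))) := fun k => by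
    rw [← hblk]
    exact (hasMaj_rate_le (hind k) hC'.le hδ0'' (HG' (s + 1) mT K r hs hK (coverCorner M (L ^ s) (L ^ (mT - s)) (coverMargin L s) k))).mono fun y y' =>
      mul_le_mul_of_nonneg_left (mul_le_mul_of_nonneg_right hCβ' (Real.exp_nonneg _)) (hind k y y')
  -- the record remainder rows at both spacings, `θ₀ = κ₀ ∕ L^s`
  have hKr : ∀ k : Fin (d + 1) → ZMod (2 * L ^ (mT - s)),
      HasMaj (BlockNorm.ofBlocks (unitTorusGeo L K M) (fun b : Tor (fine (L ^ K) M) × Fin (d + 1) => blockOf (L ^ K) M b.1))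
        (BlockNorm.ofBlocks (unitTorusGeo L K M) (fun b : Tor (fine (L ^ K) M) × Fin (d + 1) => blockOf (L ^ K) M b.1))
        (commOp (deltaOp M (L ^ K) a) (knitHR d L s mT K (L ^ K) hL k) ∘ₗ knitGR d L s mT K (L ^ K) hL hs a k)
        (fun y y' => ind ((cubeBlocks M (coverCorner M (L ^ s) (L ^ (mT - s)) (coverMargin L s) k) (L ^ (s + 1)) : Finset (Tor M)) : Set (Tor M)) y' *
          (κ₀ / ((L ^ s : ℕ) : ℝ) * Real.exp (-(δ * tdistT M y y')))) := fun k =>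
    hasMaj_rate_le (hind1 k) (by positivity) hδK2
      ((HK s mT K hs hK k).mono fun y y' =>
        mul_le_mul_of_nonneg_left (mul_le_mul_of_nonneg_right (div_le_div_of_nonneg_right hκc' hwpos.le) (Real.exp_nonneg _)) (ind_nonneg _ _))
  have hKr' : ∀ k : Fin (d + 1) → ZMod (2 * L ^ (mT - s)),
      HasMaj (BlockNorm.ofBlocks (unitTorusGeo L K M) ((fun b : Tor (fine (L ^ K) M) × Fin (d + 1) => blockOf (L ^ K) M b.1) ∘ kingPrV L K r M))
        (BlockNorm.ofBlocks (unitTorusGeo L K M) ((fun b : Tor (fine (L ^ K) M) × Fin (d + 1) => blockOf (L ^ K) M b.1) ∘ kingPrV L K r M))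
        (commOp (deltaOp M (L ^ r * L ^ K) a) (knitHR d L s mT K (L ^ r * L ^ K) hL k) ∘ₗ knitGR d L s mT K (L ^ r * L ^ K) hL hs a k)
        (fun y y' => ind ((cubeBlocks M (coverCorner M (L ^ s) (L ^ (mT - s)) (coverMargin L s) k) (L ^ (s + 1)) : Finset (Tor M)) : Set (Tor M)) y' *
          (κ₀ / ((L ^ s : ℕ) : ℝ) * Real.exp (-(δ * tdistT M y y')))) := fun k => by
    rw [← hblk]
    exact hasMaj_rate_le (hind1 k) (by positivity) hδK2'
      ((HK' s mT K r hs hK k).mono fun y y' =>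
        mul_le_mul_of_nonneg_left (mul_le_mul_of_nonneg_right (div_le_div_of_nonneg_right hκf' hwpos.le) (Real.exp_nonneg _)) (ind_nonneg _ _))
  -- the defects: cut (P-IIc) and record remainder (closed)
  have hDGc : ∀ k : Fin (d + 1) → ZMod (2 * L ^ (mT - s)),
      HasMaj (BlockNorm.ofBlocks (unitTorusGeo L K M) (fun b : Tor (fine (L ^ K) M) × Fin (d + 1) => blockOf (L ^ K) M b.1))
        (BlockNorm.ofBlocks (unitTorusGeo L K M) ((fun b : Tor (fine (L ^ K) M) × Fin (d + 1) => blockOf (L ^ K) M b.1) ∘ kingPrV L K r M))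
        (idef (pull (kingPrV L K r M)) (pull (kingPrV L K r M))
          (mulOp (chiCube M (L ^ r * L ^ K) (coverCorner M (L ^ s) (L ^ (mT - s)) (coverMargin L s) k) (L ^ (s + 1))) ∘ₗ knitGR d L s mT K (L ^ r * L ^ K) hL hs a k)
          (mulOp (chiCube M (L ^ K) (coverCorner M (L ^ s) (L ^ (mT - s)) (coverMargin L s) k) (L ^ (s + 1))) ∘ₗ knitGR d L s mT K (L ^ K) hL hs a k))
        (fun y y' => ind ((cubeBlocks M (coverCorner M (L ^ s) (L ^ (mT - s)) (coverMargin L s) k) (L ^ (s + 1)) : Finset (Tor M)) : Set (Tor M)) y *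
          ind ((cubeBlocks M (coverCorner M (L ^ s) (L ^ (mT - s)) (coverMargin L s) k) (L ^ (s + 1)) : Finset (Tor M)) : Set (Tor M)) y' * (mc * ε * Real.exp (-(δ * tdistT M y y')))) := fun k => by
    have h := HC (s + 1) mT K r hK hL hs (coverCorner M (L ^ s) (L ^ (mT - s)) (coverMargin L s) k)
    rw [hexp16] at h
    have h2 := hasMaj_rate_le (hind k) (by positivity : 0 ≤ mc * ε) hδc' h
    rw [hblk] at h2
    exact h2
  have hDK : ∀ k : Fin (d + 1) → ZMod (2 * L ^ (mT - s)),
      HasMaj (BlockNorm.ofBlocks (unitTorusGeo L K M) (fun b : Tor (fine (L ^ K) M) × Fin (d + 1) => blockOf (L ^ K) M b.1))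
        (BlockNorm.ofBlocks (unitTorusGeo L K M) ((fun b : Tor (fine (L ^ K) M) × Fin (d + 1) => blockOf (L ^ K) M b.1) ∘ kingPrV L K r M))
        (idef (pull (kingPrV L K r M)) (pull (kingPrV L K r M))
          (commOp (deltaOp M (L ^ r * L ^ K) a) (knitHR d L s mT K (L ^ r * L ^ K) hL k) ∘ₗ knitGR d L s mT K (L ^ r * L ^ K) hL hs a k)
          (commOp (deltaOp M (L ^ K) a) (knitHR d L s mT K (L ^ K) hL k) ∘ₗ knitGR d L s mT K (L ^ K) hL hs a k))
        (fun y y' => ind ((cubeBlocks M (coverCorner M (L ^ s) (L ^ (mT - s)) (coverMargin L s) k) (L ^ (s + 1)) : Finset (Tor M)) : Set (Tor M)) y' *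
          (Cr * ε * Real.exp (-(δ * tdistT M y y')))) := fun k => by
    have h := hasMaj_rate_le (hind1 k) (by positivity : 0 ≤ Cr * ε) hδ7' (H7 s mT K r hs hK hn4 k)
    rw [hblk] at h
    exact h
  -- the partition: cuts, bounds, fit, overlap
  have hcut : ∀ k : Fin (d + 1) → ZMod (2 * L ^ (mT - s)), mulOp (knitHR d L s mT K (L ^ K) hL k) ∘ₗ
      mulOp (chiCube M (L ^ K) (coverCorner M (L ^ s) (L ^ (mT - s)) (coverMargin L s) k) (L ^ (s + 1))) = mulOp (knitHR d L s mT K (L ^ K) hL k) := fun k =>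
    hcube_cut (2 * L ^ (mT - s)) (coverXi M (L ^ K) (L ^ s)) (bshiftEquiv M (L ^ K)) 0
      (chiCube_coverCorner_eq_one_side (M := M) (n := L ^ K) (m₀ := coverMargin L s) hM hw hfit1 hS 0 k)
  have hcut' : ∀ k : Fin (d + 1) → ZMod (2 * L ^ (mT - s)), mulOp (knitHR d L s mT K (L ^ r * L ^ K) hL k) ∘ₗ
      mulOp (chiCube M (L ^ r * L ^ K) (coverCorner M (L ^ s) (L ^ (mT - s)) (coverMargin L s) k) (L ^ (s + 1))) = mulOp (knitHR d L s mT K (L ^ r * L ^ K) hL k) := fun k =>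
    hcube_cut (2 * L ^ (mT - s)) (coverXi M (L ^ r * L ^ K) (L ^ s)) (bshiftEquiv M (L ^ r * L ^ K)) 0
      (chiCube_coverCorner_eq_one_side (M := M) (n := L ^ r * L ^ K) (m₀ := coverMargin L s) hM hw hfit1 hS 0 k)
  have hh : ∀ (k : Fin (d + 1) → ZMod (2 * L ^ (mT - s))) x, |knitHR d L s mT K (L ^ K) hL k x| ≤ 1 := fun k x => abs_coverH_le_one k x
  have hh' : ∀ (k : Fin (d + 1) → ZMod (2 * L ^ (mT - s))) x', |knitHR d L s mT K (L ^ r * L ^ K) hL k x'| ≤ 1 := fun k x' => abs_coverH_le_one k x'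
  have hfitH : ∀ (k : Fin (d + 1) → ZMod (2 * L ^ (mT - s))) x', |knitHR d L s mT K (L ^ r * L ^ K) hL k x' - knitHR d L s mT K (L ^ K) hL k (kingPrV L K r M x')| ≤
      π * (d + 1) / (((L ^ K : ℕ) : ℝ) * ((L ^ s : ℕ) : ℝ)) := fun k x' => abs_coverH_fine_sub_le (L := L) (kk := K) (r := r) hM hw k x'
  have hN : ∀ y : Tor M, ∑ k : Fin (d + 1) → ZMod (2 * L ^ (mT - s)),
      ind (g := unitTorusGeo L K M) ((cubeBlocks M (coverCorner M (L ^ s) (L ^ (mT - s)) (coverMargin L s) k) (L ^ (s + 1)) : Finset _) : Set _) y ≤ Nov := fun y => by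
    have h := sum_ind_cubeBlocks_le_overlap (S := L ^ (s + 1)) (m₀ := coverMargin L s) hM hw L K y
    rw [hdiv] at h
    exact h
  -- the five rows
  have e0 : parametrix (X := Tor (fine (L ^ K) M) × Fin (d + 1)) (knitHR d L s mT K (L ^ K) hL)
        (fun k : Fin (d + 1) → ZMod (2 * L ^ (mT - s)) => mulOp (chiCube M (L ^ K) (coverCorner M (L ^ s) (L ^ (mT - s)) (coverMargin L s) k) (L ^ (s + 1))) ∘ₗ knitGR d L s mT K (L ^ K) hL hs a k) =
      parametrix (X := Tor (fine (L ^ K) M) × Fin (d + 1)) (knitHR d L s mT K (L ^ K) hL) (knitGR d L s mT K (L ^ K) hL hs a) :=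
    parametrix_cut (G := knitGR d L s mT K (L ^ K) hL hs a) hcut
  have e0' : parametrix (X := Tor (fine (L ^ r * L ^ K) M) × Fin (d + 1)) (knitHR d L s mT K (L ^ r * L ^ K) hL)
        (fun k : Fin (d + 1) → ZMod (2 * L ^ (mT - s)) => mulOp (chiCube M (L ^ r * L ^ K) (coverCorner M (L ^ s) (L ^ (mT - s)) (coverMargin L s) k) (L ^ (s + 1))) ∘ₗ
          knitGR d L s mT K (L ^ r * L ^ K) hL hs a k) =
      parametrix (X := Tor (fine (L ^ r * L ^ K) M) × Fin (d + 1)) (knitHR d L s mT K (L ^ r * L ^ K) hL) (knitGR d L s mT K (L ^ r * L ^ K) hL hs a) :=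
    parametrix_cut (G := knitGR d L s mT K (L ^ r * L ^ K) hL hs a) hcut'
  have hP' := hasMaj_parametrix (g := unitTorusGeo L K M) ((fun b : Tor (fine (L ^ K) M) × Fin (d + 1) => blockOf (L ^ K) M b.1) ∘ kingPrV L K r M)
    (fun k => ((cubeBlocks M (coverCorner M (L ^ s) (L ^ (mT - s)) (coverMargin L s) k) (L ^ (s + 1)) : Finset (Tor M)) : Set (Tor M))) hβ hh' hN hGc'
  rw [e0'] at hP'
  have hIP := hasMaj_idef_parametrix (g := unitTorusGeo L K M) (fun b : Tor (fine (L ^ K) M) × Fin (d + 1) => blockOf (L ^ K) M b.1) (kingPrV L K r M)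
    (fun k => ((cubeBlocks M (coverCorner M (L ^ s) (L ^ (mT - s)) (coverMargin L s) k) (L ^ (s + 1)) : Finset (Tor M)) : Set (Tor M))) hβ (by positivity : 0 ≤ mc * ε)
    (by positivity : (0 : ℝ) ≤ π * (d + 1) / (((L ^ K : ℕ) : ℝ) * ((L ^ s : ℕ) : ℝ))) hh hh' hfitH hN hGc hGc' hDGc
  rw [e0, e0'] at hIP
  have hR := hasMaj_remainder_in (g := unitTorusGeo L K M) (fun b : Tor (fine (L ^ K) M) × Fin (d + 1) => blockOf (L ^ K) M b.1)
    (fun k => ((cubeBlocks M (coverCorner M (L ^ s) (L ^ (mT - s)) (coverMargin L s) k) (L ^ (s + 1)) : Finset (Tor M)) : Set (Tor M))) (Δ := deltaOp M (L ^ K) a)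
    (h := knitHR d L s mT K (L ^ K) hL) (G := knitGR d L s mT K (L ^ K) hL hs a) (by positivity : 0 ≤ κ₀ / ((L ^ s : ℕ) : ℝ)) hh hN hKr
  have hR' := hasMaj_remainder_in (g := unitTorusGeo L K M) ((fun b : Tor (fine (L ^ K) M) × Fin (d + 1) => blockOf (L ^ K) M b.1) ∘ kingPrV L K r M)
    (fun k => ((cubeBlocks M (coverCorner M (L ^ s) (L ^ (mT - s)) (coverMargin L s) k) (L ^ (s + 1)) : Finset (Tor M)) : Set (Tor M))) (Δ := deltaOp M (L ^ r * L ^ K) a)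
    (h := knitHR d L s mT K (L ^ r * L ^ K) hL) (G := knitGR d L s mT K (L ^ r * L ^ K) hL hs a) (by positivity : 0 ≤ κ₀ / ((L ^ s : ℕ) : ℝ)) hh' hN hKr'
  have hIR := hasMaj_idef_remainder_in (g := unitTorusGeo L K M) (fun b : Tor (fine (L ^ K) M) × Fin (d + 1) => blockOf (L ^ K) M b.1) (kingPrV L K r M)
    (fun k => ((cubeBlocks M (coverCorner M (L ^ s) (L ^ (mT - s)) (coverMargin L s) k) (L ^ (s + 1)) : Finset (Tor M)) : Set (Tor M))) (Δ := deltaOp M (L ^ K) a) (Δ' := deltaOp M (L ^ r * L ^ K) a)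
    (h := knitHR d L s mT K (L ^ K) hL) (h' := knitHR d L s mT K (L ^ r * L ^ K) hL) (G := knitGR d L s mT K (L ^ K) hL hs a) (G' := knitGR d L s mT K (L ^ r * L ^ K) hL hs a)
    (by positivity : 0 ≤ κ₀ / ((L ^ s : ℕ) : ℝ)) (by positivity : 0 ≤ Cr * ε) (by positivity : (0 : ℝ) ≤ π * (d + 1) / (((L ^ K : ℕ) : ℝ) * ((L ^ s : ℕ) : ℝ))) hh hfitH hN hKr' hDK
  rw [← hblk] at hP' hIP hR' hIR
  have ho : π * (d + 1) / (((L ^ K : ℕ) : ℝ) * ((L ^ s : ℕ) : ℝ)) ≤ π * (d + 1) * ε := by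
    rw [div_eq_mul_inv]; exact mul_le_mul_of_nonneg_left hnwε (by positivity)
  have hθκ : κ₀ / ((L ^ s : ℕ) : ℝ) ≤ κ₀ := div_le_self hκ₀ hwR
  have hNov0 : (0 : ℝ) ≤ Nov := by rw [hNov_def]; positivity
  have h1 : Nov * β ≤ Nov * β + 1 := le_add_of_nonneg_right zero_le_one
  refine ⟨hP'.mono fun y y' => mul_le_mul_of_nonneg_right h1 (Real.exp_nonneg _),
    hR.mono fun y y' => ?_, hR'.mono fun y y' => ?_,
    hIP.mono fun y y' => mul_le_mul_of_nonneg_right ?_ (Real.exp_nonneg _), hIR.mono fun y y' => mul_le_mul_of_nonneg_right ?_ (Real.exp_nonneg _)⟩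
  · rw [← mul_div_assoc]; exact le_rfl
  · rw [← mul_div_assoc]; exact le_rfl
  · have t : 2 * β * (π * (d + 1) / (((L ^ K : ℕ) : ℝ) * ((L ^ s : ℕ) : ℝ))) ≤ 2 * β * (π * (d + 1) * ε) := mul_le_mul_of_nonneg_left ho (by positivity)
    calc Nov * (2 * β * (π * (d + 1) / (((L ^ K : ℕ) : ℝ) * ((L ^ s : ℕ) : ℝ))) + mc * ε) ≤ Nov * (2 * β * (π * (d + 1) * ε) + mc * ε) :=
          mul_le_mul_of_nonneg_left (add_le_add t le_rfl) hNov0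
      _ = Nov * (2 * β * (π * (d + 1)) + mc) * ε := by ring
      _ ≤ (Nov * (2 * β * (π * (d + 1)) + mc) + 1) * ε := mul_le_mul_of_nonneg_right (le_add_of_nonneg_right zero_le_one) hε0
  · have t : κ₀ / ((L ^ s : ℕ) : ℝ) * (π * (d + 1) / (((L ^ K : ℕ) : ℝ) * ((L ^ s : ℕ) : ℝ))) ≤ κ₀ * (π * (d + 1) * ε) :=
      mul_le_mul hθκ ho (by positivity) hκ₀
    calc Nov * (κ₀ / ((L ^ s : ℕ) : ℝ) * (π * (d + 1) / (((L ^ K : ℕ) : ℝ) * ((L ^ s : ℕ) : ℝ))) + Cr * ε) ≤ Nov * (κ₀ * (π * (d + 1) * ε) + Cr * ε) :=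
          mul_le_mul_of_nonneg_left (add_le_add t le_rfl) hNov0
      _ = Nov * (κ₀ * (π * (d + 1)) + Cr) * ε := by ring
      _ ≤ (Nov * (κ₀ * (π * (d + 1)) + Cr) + 1) * ε := mul_le_mul_of_nonneg_right (le_add_of_nonneg_right zero_le_one) hε0

end Record

end Summit.QuantumFields.YangMills.BalabanUVNodes.N15.Gluing

end
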